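import Summits.QuantumFields.YangMills.Theorems.UnitScaleTiltProp7FlatRRowConst
import Summits.QuantumFields.YangMills.Theorems.UnitScaleTiltProp7LinAvgAdjoint
import Summits.QuantumFields.YangMills.Theorems.UnitScaleTiltProp7PinnedHodgeSplit
import Literature.MathematicalPhysics.QuantumFieldTheory.Balaban1983to89.B6VecIMSV1
import Literature.MathematicalPhysics.QuantumFieldTheory.Balaban1983to89.B5Positivity172Lattice
import HarnessLib

/-!
# Route `UnitScaleTilt`, crux K1 «MinimiserStabilityRegPr» (stmt-QuantumFields-19200), route-R E′ S3 ∕ line «HKGK-ANALYTIC», row (C1) FLAT — THE INTERPOLANT'S ORTH LETTERS: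
# for the flat curl-minimal interpolant `A` of a coarse weight `ν` (`Δ A_κ = ((Q_k)ᵀν)_κ`, [Balaban1984PropagatorsI] (1.18), (1.21)):
# (a) `Σ_y ν⟨y,κ⟩ = 0` is AUTOMATIC;  (b) `A ⊥ ker Q_k` in the Dirichlet form `⟨curl·,curl·⟩ + ⟨div·,div·⟩`;  (c) if `ν` is CO-CLOSED then `div A = 0` (Landau gauge is automatic)
# and hence ORTH `⟨curl A, curl Z⟩ = 0 ∀ Z ∈ ker Q_k` (★ym-ust-19200-w4 g7's LOCATE v2 §5 (i), flat model; LOCATE-C1 e9fef8d2, 2026-08-29)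

Cell `ym3-torus`, twin-width seat `ym-ust-19936-w8` (gen 5).  THEOREMS ONLY (0 `def`, 0 `sorry`); `--supports stmt-QuantumFields-19200 --as helper`, count-neutral.  YM₃ on T³ is a
ladder rung (R3), not the Clay problem; nothing here claims S3, hKg-K, ℛ-ROW★, E′, the stub, the crux, d = 4 or the mass gap.

LETTERS (as in ✓`Prop7FlatRRowConst`, any `P : Params`, level `k ≤ m + K`): `ν : PBond P k → ℝ` the coarse weight; `f` its ABSTRACT `Q_k`-transpose,
`hf : ∀ Y, Σ_c ν(c)·(bondAvgIter k Y)(c) = Σ_b f(b)·Y(b)`; `A : PBond P 0 → ℝ` with `hLap : laplace 1 (A ·,dir) = f` bondwise; co-closedness of `ν` in px12's POINTWISE letter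
`hνco : ∀ y, Σ_μ ν⟨y,μ⟩ = Σ_μ ν⟨y − e_μ, μ⟩` (✓`Prop7LinAvgAdjoint.sum_smul_coarseGrad_eq_zero` turns it into the weak form).

WHAT IS PROVED (ns `…Theorems.Prop7FlatInterpolantOrth`):
* §1 `sum_laplace_eq_zero` (`Σ_x (Δψ)(x) = 0`; ✓`diverg_grad` + ✓`Prop7PinnedHodgeSplit.sum_diverg_eq_zero`).
* §2 ★ `sum_dir_weight_eq_zero` — (`hf`, `hLap`) ALONE force `Σ_y ν⟨y,κ⟩ = 0` for every direction `κ` (`Q_k` fixes direction-constants, lit ✓`B5Positivity172Lattice.bondAvgIter_dirConst`);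
  ★★ `flatRRow_const_of_pairing` (+ `_T3`) — ✓p681767 `flatRRow_const` WITHOUT its hypothesis `hν`.
* §3 ★ `dirichlet_orth_of_kerQ` — `Σ_p (curl Z)(curl A) + Σ_x (div Z)(div A) = 0` for every real `Z` with `Q_kZ = 0` (lit ✓`B6VecIMSV1.sum_mul_laplace_eq_curl_add_diverg` = (1.21) polarised;
  no co-closedness needed).
* §4 ★ `diverg_transpose_eq_zero` — co-closed `ν` ⇒ `div f = 0` (test functions; lit ✓`B5Eq120IterProof.bondAvgIter_grad` `Q_k∂ = ∂_{L^{−k}}Q′_k`); ★★ `diverg_interpolant_eq_zero` — co-closed `ν`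
  ⇒ `div A = 0` (IMS identity with `B := ∂(div A)`, ✓`curl_grad`, ✓`diverg_grad`, lit ✓`const_of_laplace_eq_zero`, ✓`sum_diverg_eq_zero`).
* §5 ★★★ `curl_orth_of_kerQ` (+ `_T3`) — co-closed `ν` ⇒ `Σ_p (curl Z)(p)·(curl A)(p) = 0` for every real `Z ∈ ker Q_k`.
HONEST SCOPE.  Flat linear bookkeeping over landed identities; the CURVED half of (C1) («`J_W = Q_W^*λ`», «`λ` covariantly co-closed at `V`») is ALREADY routeR-w2's
✓`Prop7FirstVariationMultiplierBoundWeakEL.exists_multiplier_field_weakEL` (i)(ii) and is not touched here; «`𝒦A = Qᵀν` + remainder» is (R-crit-loc), curved-only.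

References: T. Bałaban, CMP 95 (1984) 17–40 [Balaban1984PropagatorsI] ((1.4) p.18, (1.18)–(1.20) p.20, (1.21) p.21, (1.57) p.27, p.22 text); CMP 99 (1985) 389–434
[Balaban1985BackgroundPropagators] (Thm 3.11 p.416).
-/

set_option autoImplicit false

noncomputable section

open scoped BigOperators

namespace Summit.QuantumFields.YangMills.Theorems.Prop7FlatInterpolantOrth

open Literature.MathematicalPhysics.QuantumFieldTheory.Balaban1983to89
open Finset LatticeFieldCalculus
open B10StarCount (sum_pbond)
open B5Positivity172Lattice (dirConst dirConst_apply bondAvgIter_dirConst const_of_laplace_eq_zero)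
open B5Eq120IterProof (bondAvgIter_grad)
open B6VecIMSV1 (sum_mul_laplace_eq_curl_add_diverg)
open Summit.QuantumFields.YangMills.Theorems.Prop7PinnedHodgeSplit (sum_diverg_eq_zero)
open Summit.QuantumFields.YangMills.Theorems.Prop7LinAvgAdjoint (sum_smul_coarseGrad_eq_zero)
open Summit.QuantumFields.YangMills.Theorems.Prop7FlatRRowConst (flatRRow_const)

variable {P : Params} {k j : ℕ}

/-! ## §1 A Laplacian sums to zero -/

/-- `Σ_x (Δψ)(x) = 0` on the torus (`Δ = ∂*∂` and a divergence sums to zero). [cite: Balaban1984PropagatorsI, (1.21) p.21] -/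
theorem sum_laplace_eq_zero (c : ℝ) (ψ : SiteField P j ℝ) : ∑ x : Site P j, laplace c ψ x = 0 := by
  have h := sum_diverg_eq_zero c (grad c ψ)
  rw [diverg_grad] at h
  exact h

/-! ## §2 The mean of the weight is automatic -/

/-- ★ **`Σ_y ν⟨y,κ⟩ = 0` IS AUTOMATIC**: if `f` is the `Q_k`-transpose of `ν` (`hf`) and `f_κ = ΔA_κ` (`hLap`), then for every direction `κ`, `Σ_y ν⟨y,κ⟩ = Σ_c ν(c)(Q_k1_κ)(c) = Σ_x f⟨x,κ⟩ =
Σ_x (ΔA_κ)(x) = 0` — `Q_k` fixes direction-constant fields ((1.57)) and a Laplacian sums to zero. [cite: Balaban1984PropagatorsI, (1.57) p.27, (1.21) p.21] -/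
theorem sum_dir_weight_eq_zero (ν : PBond P k → ℝ) (A f : PBond P 0 → ℝ)
    (hf : ∀ Y : PBond P 0 → ℝ, ∑ c : PBond P k, ν c * bondAvgIter k Y c = ∑ b : PBond P 0, f b * Y b)
    (hLap : ∀ b : PBond P 0, laplace 1 (fun z => A ⟨z, b.dir⟩) b.src = f b) (κ : Fin P.d) :
    ∑ y : Site P k, ν ⟨y, κ⟩ = 0 := by
  classical
  have h := hf (dirConst fun μ => if μ = κ then 1 else 0)
  rw [bondAvgIter_dirConst] at h
  have hL : ∑ c : PBond P k, ν c * dirConst (fun μ => if μ = κ then (1 : ℝ) else 0) c = ∑ y : Site P k, ν ⟨y, κ⟩ := by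
    rw [sum_pbond]
    refine Finset.sum_congr rfl fun y _ => ?_
    simp only [dirConst_apply, mul_ite, mul_one, mul_zero, Finset.sum_ite_eq', Finset.mem_univ, if_true]
  have hR : ∑ b : PBond P 0, f b * dirConst (fun μ => if μ = κ then (1 : ℝ) else 0) b = ∑ x : Site P 0, f ⟨x, κ⟩ := by
    rw [sum_pbond]
    refine Finset.sum_congr rfl fun x _ => ?_
    simp only [dirConst_apply, mul_ite, mul_one, mul_zero, Finset.sum_ite_eq', Finset.mem_univ, if_true]
  rw [hL, hR] at h
  rw [h]
  have e : ∀ x : Site P 0, f ⟨x, κ⟩ = laplace 1 (fun z => A ⟨z, κ⟩) x := fun x => (hLap ⟨x, κ⟩).symm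
  rw [Finset.sum_congr rfl fun x _ => e x]
  exact sum_laplace_eq_zero 1 _

/-- ★★ **`ℛ_flat ≤ C_B` WITHOUT THE MEAN HYPOTHESIS**: ✓`Prop7FlatRRowConst.flatRRow_const` with `hν` discharged by `sum_dir_weight_eq_zero` — for the flat curl-minimal interpolant `A` of ANY
coarse weight `ν` (`hf`, `hLap`, `Σ_x A⟨x,κ⟩ = 0`), `(L^k)²·Σ_b Σ_ν (A(b+e_ν) − A(b))² ≤ C_B·Σ_b A(b)²`, `C_B = dπ² + (π²∕4)^{d+1}(dπ²)²∕4`.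
[cite: Balaban1984PropagatorsI, (1.18) p.20, (1.21) p.21; Balaban1985BackgroundPropagators, Thm 3.11 p.416] -/
theorem flatRRow_const_of_pairing (hk : k ≤ P.m + P.K) (ν : PBond P k → ℝ) (A f : PBond P 0 → ℝ)
    (hf : ∀ Y : PBond P 0 → ℝ, ∑ c : PBond P k, ν c * bondAvgIter k Y c = ∑ b : PBond P 0, f b * Y b)
    (hLap : ∀ b : PBond P 0, laplace 1 (fun z => A ⟨z, b.dir⟩) b.src = f b)
    (hA0 : ∀ κ : Fin P.d, ∑ x : Site P 0, A ⟨x, κ⟩ = 0) :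
    ((P.L : ℝ) ^ k) ^ 2 * ∑ b : PBond P 0, ∑ ν' : Fin P.d, (A ⟨b.src.shift ν', b.dir⟩ - A b) ^ 2
      ≤ (P.d * Real.pi ^ 2 + (Real.pi ^ 2 / 4) ^ (P.d + 1) * (P.d * Real.pi ^ 2) ^ 2 / 4) * ∑ b : PBond P 0, A b ^ 2 :=
  flatRRow_const hk ν (fun κ => sum_dir_weight_eq_zero ν A f hf hLap κ) A f hf hLap hA0

/-- ★ **THE T³ INSTANCE** (`k = K − n`, run `K` of a T³ family): `ℓ²·Σ_bΣ_ν(A(b+e_ν) − A(b))² ≤ C_B·Σ_b A(b)²` for the flat curl-minimal interpolant of ANY level-`(K−n)` weight.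
[cite: Balaban1984PropagatorsI, (1.18) p.20, (1.21) p.21; Balaban1985BackgroundPropagators, Thm 3.11 p.416] -/
theorem flatRRow_const_of_pairing_T3 (F : T3ContinuumYM3Torus.T3Family) (K n : ℕ) (ν : PBond (F.P K) (K - n) → ℝ)
    (A f : PBond (F.P K) 0 → ℝ)
    (hf : ∀ Y : PBond (F.P K) 0 → ℝ, ∑ c : PBond (F.P K) (K - n), ν c * bondAvgIter (K - n) Y c = ∑ b : PBond (F.P K) 0, f b * Y b)
    (hLap : ∀ b : PBond (F.P K) 0, laplace 1 (fun z => A ⟨z, b.dir⟩) b.src = f b)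
    (hA0 : ∀ κ : Fin (F.P K).d, ∑ x : Site (F.P K) 0, A ⟨x, κ⟩ = 0) :
    ((F.L : ℝ) ^ (K - n)) ^ 2 * ∑ b : PBond (F.P K) 0, ∑ ν' : Fin (F.P K).d, (A ⟨b.src.shift ν', b.dir⟩ - A b) ^ 2
      ≤ ((F.P K).d * Real.pi ^ 2 + (Real.pi ^ 2 / 4) ^ ((F.P K).d + 1) * ((F.P K).d * Real.pi ^ 2) ^ 2 / 4) * ∑ b : PBond (F.P K) 0, A b ^ 2 := by
  have hk : K - n ≤ (F.P K).m + (F.P K).K := by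
    have := F.hm
    show K - n ≤ F.m + K
    omega
  exact flatRRow_const_of_pairing (P := F.P K) hk ν A f hf hLap hA0

/-! ## §3 Dirichlet orthogonality to `ker Q_k` -/

/-- ★ **THE INTERPOLANT IS DIRICHLET-ORTHOGONAL TO `ker Q_k`** (no co-closedness needed): for every real fine `Z` with `Q_kZ = 0`,
`Σ_p (curl Z)(p)(curl A)(p) + Σ_x (div Z)(x)(div A)(x) = Σ_μΣ_x Z_μ(x)(ΔA_μ)(x) = Σ_b f(b)Z(b) = Σ_c ν(c)(Q_kZ)(c) = 0` ((1.21) polarised). [cite: Balaban1984PropagatorsI, (1.21) p.21, (1.18) p.20] -/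
theorem dirichlet_orth_of_kerQ (ν : PBond P k → ℝ) (A f : PBond P 0 → ℝ)
    (hf : ∀ Y : PBond P 0 → ℝ, ∑ c : PBond P k, ν c * bondAvgIter k Y c = ∑ b : PBond P 0, f b * Y b)
    (hLap : ∀ b : PBond P 0, laplace 1 (fun z => A ⟨z, b.dir⟩) b.src = f b)
    (Z : PBond P 0 → ℝ) (hZ : ∀ c : PBond P k, bondAvgIter k Z c = 0) :
    ∑ p : Plaq P 0, curl 1 Z p * curl 1 A p + ∑ x : Site P 0, diverg 1 Z x * diverg 1 A x = 0 := by
  rw [← sum_mul_laplace_eq_curl_add_diverg 1 Z A]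
  have e : ∀ (μ : Fin P.d) (x : Site P 0), Z ⟨x, μ⟩ * laplace 1 (fun z => A ⟨z, μ⟩) x = f ⟨x, μ⟩ * Z ⟨x, μ⟩ := by
    intro μ x
    have h1 : laplace 1 (fun z => A ⟨z, μ⟩) x = f ⟨x, μ⟩ := hLap ⟨x, μ⟩
    rw [h1, mul_comm]
  calc ∑ μ : Fin P.d, ∑ x : Site P 0, Z ⟨x, μ⟩ * laplace 1 (fun z => A ⟨z, μ⟩) x
      = ∑ μ : Fin P.d, ∑ x : Site P 0, f ⟨x, μ⟩ * Z ⟨x, μ⟩ :=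
        Finset.sum_congr rfl fun μ _ => Finset.sum_congr rfl fun x _ => e μ x
    _ = ∑ b : PBond P 0, f b * Z b := by rw [sum_pbond, Finset.sum_comm]
    _ = ∑ c : PBond P k, ν c * bondAvgIter k Z c := (hf Z).symm
    _ = 0 := Finset.sum_eq_zero fun c _ => by rw [hZ c, mul_zero]

/-! ## §4 Co-closed weights: the transpose and the interpolant are divergence-free -/

/-- ★ **A CO-CLOSED WEIGHT HAS A DIVERGENCE-FREE TRANSPOSE**: if `Σ_μ ν⟨y,μ⟩ = Σ_μ ν⟨y−e_μ,μ⟩` at every coarse site, then `div f = 0` — test against any `φ`: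
`Σ_x φ·(div f) = Σ_b (∂φ)·f = Σ_c ν·Q_k(∂φ) = Σ_c ν·∂_{L^{−k}}(Q′_kφ) = 0` ((1.20) `Q_k∂ = ∂Q′_k` and weak co-closedness); then `φ := div f`.
[cite: Balaban1984PropagatorsI, (1.20) p.20, (1.21) p.21] -/
theorem diverg_transpose_eq_zero (hk : k ≤ P.m + P.K) (ν : PBond P k → ℝ)
    (hνco : ∀ y : Site P k, ∑ μ : Fin P.d, ν ⟨y, μ⟩ = ∑ μ : Fin P.d, ν ⟨y.unshift μ, μ⟩) (f : PBond P 0 → ℝ)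
    (hf : ∀ Y : PBond P 0 → ℝ, ∑ c : PBond P k, ν c * bondAvgIter k Y c = ∑ b : PBond P 0, f b * Y b) (x : Site P 0) :
    diverg 1 f x = 0 := by
  have htest : ∀ φ : SiteField P 0 ℝ, ∑ z : Site P 0, φ z * diverg 1 f z = 0 := by
    intro φ
    rw [← sum_grad_mul 1 φ f]
    have h := hf (grad 1 φ)
    rw [bondAvgIter_grad k hk 1 φ] at h
    have h0 : ∑ c : PBond P k, ν c * grad (1 / (P.L : ℝ) ^ k) (siteAvgIter k φ) c = 0 := by
      have hw := sum_smul_coarseGrad_eq_zero (R := ℝ) (M := ℝ) ν hνco (fun y => (1 / (P.L : ℝ) ^ k) * siteAvgIter k φ y)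
      rw [← hw]
      refine Finset.sum_congr rfl fun c _ => ?_
      simp only [grad, smul_eq_mul, mul_sub]
    rw [h0] at h
    calc ∑ b : PBond P 0, grad 1 φ b * f b = ∑ b : PBond P 0, f b * grad 1 φ b := Finset.sum_congr rfl fun b _ => mul_comm _ _
      _ = 0 := h.symm
  have hsq : ∑ z : Site P 0, diverg 1 f z * diverg 1 f z = 0 := htest (diverg 1 f)
  exact mul_self_eq_zero.mp
    ((Finset.sum_eq_zero_iff_of_nonneg fun z _ => mul_self_nonneg (diverg 1 f z)).mp hsq x (Finset.mem_univ _))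

/-- ★★ **THE LANDAU GAUGE OF THE INTERPOLANT IS AUTOMATIC**: for a CO-CLOSED weight `ν`, its flat curl-minimal interpolant (`hf`, `hLap`) is divergence-free, `div A = 0` — with `ψ := div A`:
`Σ_b (∂ψ)² = Σ_x ψ·Δψ = Σ_p curl(∂ψ)·curl A + Σ_x div(∂ψ)·div A` (`curl ∂ = 0`, `div ∂ = Δ`) `= Σ_μΣ_x (∂ψ)_μ·ΔA_μ` ((1.21) polarised) `= Σ_b (∂ψ)·f = Σ_x ψ·div f = 0`; so `∂ψ = 0`, `ψ` is
constant (p. 22), and `Σ_x ψ = 0`. [cite: Balaban1984PropagatorsI, (1.21) p.21, p.22 (text), (1.20) p.20] -/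
theorem diverg_interpolant_eq_zero (hk : k ≤ P.m + P.K) (ν : PBond P k → ℝ)
    (hνco : ∀ y : Site P k, ∑ μ : Fin P.d, ν ⟨y, μ⟩ = ∑ μ : Fin P.d, ν ⟨y.unshift μ, μ⟩) (A f : PBond P 0 → ℝ)
    (hf : ∀ Y : PBond P 0 → ℝ, ∑ c : PBond P k, ν c * bondAvgIter k Y c = ∑ b : PBond P 0, f b * Y b)
    (hLap : ∀ b : PBond P 0, laplace 1 (fun z => A ⟨z, b.dir⟩) b.src = f b) (x : Site P 0) :
    diverg 1 A x = 0 := by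
  have hIMS := sum_mul_laplace_eq_curl_add_diverg 1 (grad 1 (diverg 1 A)) A
  -- the left side of the polarised (1.21) vanishes
  have hleft : ∑ μ : Fin P.d, ∑ z : Site P 0, grad 1 (diverg 1 A) ⟨z, μ⟩ * laplace 1 (fun w => A ⟨w, μ⟩) z = 0 := by
    have e : ∀ (μ : Fin P.d) (z : Site P 0), grad 1 (diverg 1 A) ⟨z, μ⟩ * laplace 1 (fun w => A ⟨w, μ⟩) z = grad 1 (diverg 1 A) ⟨z, μ⟩ * f ⟨z, μ⟩ := by
      intro μ z
      have h1 : laplace 1 (fun w => A ⟨w, μ⟩) z = f ⟨z, μ⟩ := hLap ⟨z, μ⟩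
      rw [h1]
    calc ∑ μ : Fin P.d, ∑ z : Site P 0, grad 1 (diverg 1 A) ⟨z, μ⟩ * laplace 1 (fun w => A ⟨w, μ⟩) z
        = ∑ μ : Fin P.d, ∑ z : Site P 0, grad 1 (diverg 1 A) ⟨z, μ⟩ * f ⟨z, μ⟩ :=
          Finset.sum_congr rfl fun μ _ => Finset.sum_congr rfl fun z _ => e μ z
      _ = ∑ b : PBond P 0, grad 1 (diverg 1 A) b * f b := by rw [sum_pbond, Finset.sum_comm]
      _ = ∑ z : Site P 0, diverg 1 A z * diverg 1 f z := sum_grad_mul 1 (diverg 1 A) f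
      _ = 0 := Finset.sum_eq_zero fun z _ => by rw [diverg_transpose_eq_zero hk ν hνco f hf z, mul_zero]
  -- the right side is `Σ_x Δψ·ψ`
  have hright : ∑ p : Plaq P 0, curl 1 (grad 1 (diverg 1 A)) p * curl 1 A p + ∑ z : Site P 0, diverg 1 (grad 1 (diverg 1 A)) z * diverg 1 A z
      = ∑ z : Site P 0, laplace 1 (diverg 1 A) z * diverg 1 A z := by
    simp only [curl_grad, zero_mul, Finset.sum_const_zero, zero_add, diverg_grad]
  -- hence `Σ_b (∂ψ)(b)² = 0`
  have hgrad : ∑ b : PBond P 0, grad 1 (diverg 1 A) b * grad 1 (diverg 1 A) b = 0 := by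
    rw [sum_grad_mul 1 (diverg 1 A) (grad 1 (diverg 1 A)), diverg_grad]
    have h := hIMS
    rw [hleft, hright] at h
    calc ∑ z : Site P 0, diverg 1 A z * laplace 1 (diverg 1 A) z = ∑ z : Site P 0, laplace 1 (diverg 1 A) z * diverg 1 A z := Finset.sum_congr rfl fun z _ => mul_comm _ _
      _ = 0 := h.symm
  have hg0 : ∀ b : PBond P 0, grad 1 (diverg 1 A) b = 0 := fun b =>
    mul_self_eq_zero.mp ((Finset.sum_eq_zero_iff_of_nonneg fun b _ => mul_self_nonneg (grad 1 (diverg 1 A) b)).mp hgrad b (Finset.mem_univ _))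
  -- `Δψ = 0`, so `ψ` is constant, and it sums to zero
  have hlap : laplace 1 (diverg 1 A) = 0 := by
    rw [← diverg_grad]
    funext y
    simp only [diverg, hg0, sub_self, smul_zero, Finset.sum_const_zero, Pi.zero_apply]
  have hconst := const_of_laplace_eq_zero (P := P) (j := 0) one_ne_zero hlap
  have hsum : ∑ y : Site P 0, diverg 1 A y = 0 := sum_diverg_eq_zero 1 A
  have hmul : (Fintype.card (Site P 0) : ℝ) * diverg 1 A default = 0 := by
    rw [← hsum, Finset.sum_congr rfl fun y _ => hconst y, Finset.sum_const, Finset.card_univ, nsmul_eq_mul]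
  have hcard : (Fintype.card (Site P 0) : ℝ) ≠ 0 := Nat.cast_ne_zero.mpr Fintype.card_ne_zero
  rw [hconst x]
  exact (mul_eq_zero.mp hmul).resolve_left hcard

/-! ## §5 ORTH -/

/-- ★★★ **ORTH — `⟨curl A, curl Z⟩ = 0` FOR EVERY `Z ∈ ker Q_k`**: for a CO-CLOSED coarse weight `ν` and its flat curl-minimal interpolant `A` (`hf`, `hLap`), `Σ_p (curl Z)(p)·(curl A)(p) = 0`
for every real fine `Z` with `Q_kZ = 0` (§3 + §4: the divergence term drops because `div A = 0`).  This is the flat model of (C1)'s last clause «`⟪curl σ_n, curl Z⟫ = 0 ∀ Z ∈ ker Q`».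
[cite: Balaban1984PropagatorsI, (1.18) p.20, (1.20) p.20, (1.21) p.21] -/
theorem curl_orth_of_kerQ (hk : k ≤ P.m + P.K) (ν : PBond P k → ℝ)
    (hνco : ∀ y : Site P k, ∑ μ : Fin P.d, ν ⟨y, μ⟩ = ∑ μ : Fin P.d, ν ⟨y.unshift μ, μ⟩) (A f : PBond P 0 → ℝ)
    (hf : ∀ Y : PBond P 0 → ℝ, ∑ c : PBond P k, ν c * bondAvgIter k Y c = ∑ b : PBond P 0, f b * Y b)
    (hLap : ∀ b : PBond P 0, laplace 1 (fun z => A ⟨z, b.dir⟩) b.src = f b)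
    (Z : PBond P 0 → ℝ) (hZ : ∀ c : PBond P k, bondAvgIter k Z c = 0) :
    ∑ p : Plaq P 0, curl 1 Z p * curl 1 A p = 0 := by
  have h := dirichlet_orth_of_kerQ ν A f hf hLap Z hZ
  have h0 : ∑ x : Site P 0, diverg 1 Z x * diverg 1 A x = 0 :=
    Finset.sum_eq_zero fun x _ => by rw [diverg_interpolant_eq_zero hk ν hνco A f hf hLap x, mul_zero]
  rw [h0, add_zero] at h
  exact h

/-- ★ **ORTH, THE T³ INSTANCE** (`k = K − n`, run `K` of a T³ family). [cite: Balaban1984PropagatorsI, (1.18) p.20, (1.20) p.20, (1.21) p.21] -/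
theorem curl_orth_of_kerQ_T3 (F : T3ContinuumYM3Torus.T3Family) (K n : ℕ) (ν : PBond (F.P K) (K - n) → ℝ)
    (hνco : ∀ y : Site (F.P K) (K - n), ∑ μ : Fin (F.P K).d, ν ⟨y, μ⟩ = ∑ μ : Fin (F.P K).d, ν ⟨y.unshift μ, μ⟩)
    (A f : PBond (F.P K) 0 → ℝ)
    (hf : ∀ Y : PBond (F.P K) 0 → ℝ, ∑ c : PBond (F.P K) (K - n), ν c * bondAvgIter (K - n) Y c = ∑ b : PBond (F.P K) 0, f b * Y b)
    (hLap : ∀ b : PBond (F.P K) 0, laplace 1 (fun z => A ⟨z, b.dir⟩) b.src = f b)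
    (Z : PBond (F.P K) 0 → ℝ) (hZ : ∀ c : PBond (F.P K) (K - n), bondAvgIter (K - n) Z c = 0) :
    ∑ p : Plaq (F.P K) 0, curl 1 Z p * curl 1 A p = 0 := by
  have hk : K - n ≤ (F.P K).m + (F.P K).K := by
    have := F.hm
    show K - n ≤ F.m + K
    omega
  exact curl_orth_of_kerQ (P := F.P K) hk ν hνco A f hf hLap Z hZ

end Summit.QuantumFields.YangMills.Theorems.Prop7FlatInterpolantOrth

end
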